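import Summits.BirchSwinnertonDyer.BirchSwinnertonDyer.Theorems.QuadraticBranchSignedControlPlusEtaNonsurjThetaFunctionalEquationNormCoordinateMainConjecture
import Summits.BirchSwinnertonDyer.BirchSwinnertonDyer.Theorems.QuadraticBranchSignedControlPlusEtaNonsurjThetaFunctionalEquationNormCoordinateLeadingTwo
import Mathlib.RingTheory.Polynomial.Eisenstein.Basic
import Mathlib.NumberTheory.Padics.Hensel
import HarnessLib

/-!
# Route `QuadraticBranchSignedControl` (rung K8, cell `bsd-potss`), residual crux `PlusEtaMainConjectureNonsurj`
# (stmt-BirchSwinnertonDyer-19606): THE FUNCTIONAL EQUATION ON THE QUADRATIC BRANCH, XXXIV — THE FACTORISATION TYPE OF THE NORM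
# POLYNOMIAL FROM TWO DIGITS, AND THE ALL-OR-NOTHING KATO READING: **`H_an` irreducible over `ℤ_p` ⟹ `H_alg ∈ {1, H_an}`**;
# **`p² ∤ h₀` ⟹ `H_an` Eisenstein ⟹ irreducible**; `k = 2`: **residual discriminant a non-square ⟹ irreducible**, **`p ∥ h₁ ∧ p³ ∣ h₀` ⟹
# `H_an = (Z − z₁)(Z − z₂)` SPLITS**, `v(z₂) = 1`, `v(z₁) ≥ 2`, and then `H_alg ∈ {1, Z − z₁, Z − z₂, H_an}` (seat `bsd-potss-k8eta-c2` g31; kernel, fact-free)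

WHY. Part XXXIII: Kobayashi's `pⁿ·L_p⁺(V, η, X) ∈ Char` reads `H_alg ∣ H_an` in `ℤ_p[Z]` for the norm polynomials of Parts XXVI/XXVII (`H_alg`
granted Kim 3.11η). How much that pins `H_alg` down depends only on the FACTORISATION TYPE of `H_an` over `ℤ_p`, and the census instruments of
the lineage (P-29R / P-30Z / P-30M: `H_an mod 25`, `mod 125` at `p = 5` on 44 rows) display exactly the digits that decide it in low degree.
THIS FILE proves the decision rules and the resulting constraint on ANY monic divisor (hence on `H_alg`):
* (§100) `H_an` IRREDUCIBLE ⟹ every monic divisor is `1` or `H_an`: under the Kato reading **`H_alg = 1 ∨ H_alg = H_an`**, i.e.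
  **`λ_alg − r_alg ∈ {0, λ_an − r_an}`** ("all or nothing");
* (§101) ONE DIGIT: a distinguished `H` with **`p² ∤ h₀` is EISENSTEIN at `pℤ_p`, hence irreducible** (Mathlib `IsEisensteinAt.irreducible`) — the
  same digit `h₀ = coeff_{r₀}(P) mod p²` as Part XXX's one-digit zero test; P-30L: 17 of the 36 rows with `λ > r₀` (5 of them with `k ≥ 2`:
  435600ui1, cm1849a1_29, cm27a4_1, cm4489a1_8, cmsextic_16);
* (§102) `k = 2`, SECOND DIGIT: `h₁ = pa`, `h₀ = p²b` and **`a² − 4b` not a square mod `p` ⟹ no root in `ℤ_p` ⟹ irreducible** (a root `z = py`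
  would give `(2y + a)² ≡ a² − 4b`); P-30M: 78400gw1 ~ cm49a1_m8 ~ cm49a3_m8 (`H ≡ Z² + 90Z + 100 (mod 125)`: `a ≡ 3`, `b ≡ 4`, `a² − 4b ≡ 3`,
  a non-residue mod `5`);
* (§103) `k = 2`, SPLIT: **`‖h₁‖ = p⁻¹` and `‖h₀‖ < p⁻²` ⟹ `H = (Z − z₁)(Z − z₂)` with `‖z₁‖ < p⁻¹ = ‖z₂‖`** (Hensel at `0` and at `−h₁`), `z₂` is
  NOT a square (odd valuation: by Parts XXVIII/XXIX no zero of `L` lies over `z₂`); P-30M: cm256j8000_m7 (`H ≡ Z² + 30Z`), cm36a2_13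
  (`Z² + 105Z`) `(mod 125)` (cmsextic_m49, `Z² + 50Z`, has `v(h₁) = 2`: undecided at this level);
* (§104) monic divisors of `(Z − z₁)(Z − z₂)` are `1, Z − z₁, Z − z₂` or the product (no unique factorisation used: a monic linear divisor
  `Z + c` has `−c ∈ {z₁, z₂}`): under the Kato reading on a split row **`H_alg ∈ {1, Z − z₁, Z − z₂, H_an}`**, `λ_alg − r_alg ∈ {0, 2, 4}`.
So of the 17 level-4 rows with `k ≥ 2`, the digits in hand decide 10 (irreducible 8, split 2); undecided 7: cm27a4_101, cm36a2_133, cm36a2_61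
(`k = 2`, `h₀ ≡ h₁ ≡ 0 (mod 25)`, no level 6), cmsextic_m49 (`k = 2`, `v(h₁) = 2`, `v(h₀) ≥ 3`), cm27a4_157, cm36a2_449 (`k = 3`), cm27a4_197
(`k = 4`) — display P-31F of this seat (`k8eta-c2/g31/tables/P31F.tsv`).

MATHEMATICS. (§100) `B = A·G` irreducible ⟹ `A` or `G` a unit; monic units are `1`; a unit cofactor makes `A` associated to `B`, and associated
monics are equal. (§101) distinguished = monic with lower coefficients in `𝔪 = (p)`; `𝔪² = (p²)`. (§102) roots of a distinguished polynomial lie in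
`𝔪` (Part XXXI); `H(py) = p²(y² + ay + b)`; `4(y² + ay + b) = (2y + a)² − (a² − 4b)`; a monic quadratic over a domain with no root is irreducible
(Mathlib `Monic.irreducible_iff_roots_eq_zero_of_degree_le_three`). (§103) `H(0) = h₀`, `H′(0) = h₁`; `H(−h₁) = h₀`, `H′(−h₁) = −h₁`; Hensel
(`‖H(a₀)‖ < ‖H′(a₀)‖²`) twice; `‖z₂ + h₁‖ < ‖h₁‖ ⟹ ‖z₂‖ = ‖h₁‖`; `H = (Z − z₂)·Q`, `Q` monic linear with `Q(z₁) = 0`. (§104) degree count + evaluation.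

WHAT (14 theorems). §100 `eq_one_or_eq_of_monic_dvd_irreducible`, **`normPoly_eq_one_or_eq_of_pow_mul_mem_span_of_irreducible`**; §101
**`isEisensteinAt_of_isDistinguishedAt`**, **`irreducible_of_isDistinguishedAt_of_not_sq_dvd`**, `coeff_weierstrass_order_eq_coeff_zero`,
**`normPoly_eq_one_or_eq_of_not_sq_dvd_coeff`** (one-digit all-or-nothing); §102 `eval_eq_of_natDegree_two`, **`eval_ne_zero_of_residualDisc_nonsquare`**,
**`irreducible_of_residualDisc_nonsquare`**; §103 `eq_quadratic_of_monic`, **`exists_split_of_norm_coeff`** (Hensel), `not_isSquare_of_norm_eq_inv`;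
§104 `eq_of_monic_dvd_X_sub_C_mul`, **`normPoly_mem_four_of_pow_mul_mem_span_of_split`** (split all-four reading).

HONEST FRAMING (cell `bsd-potss`; FULL-BSD rank ≤ 1 programme, HUMAN RULING D-0036/D-0074): TOOL THEOREMS ONLY — pure algebra of `ℤ_p[Z]` and
`Λ`; no definition, no named fact, no `sorry`, axioms standard; the row names above are CENSUS labels (digits measured by kit jobs j337977 /
j339502, never Lean facts); nothing about (A), (C1⁺_η), C-cc-1 or `BSD(W,p)` of any pair is claimed; no stub of 19606 is proved; crux and route
OPEN; nothing booked. `--supports stmt-BirchSwinnertonDyer-19606`.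

References: [Washington1997] §7.1 (Thm. 7.3); [Kobayashi2003] Thm. 4.1 (p. 8); [GreenbergVatsal2000] p. 4; K. Conrad, Hensel's lemma (Mathlib
`hensels_lemma`); Eisenstein's criterion (Mathlib `Polynomial.IsEisensteinAt.irreducible`). Tree: Parts XXVI, XXX, XXXI, XXXII, XXXIII.
-/

set_option autoImplicit false
set_option linter.dupNamespace false
noncomputable section

open scoped Classical Topology

open PowerSeries Literature.NumberTheory.EllipticCurves Literature.NumberTheory.EllipticCurves.IwasawaAlgebra

namespace Summit.BirchSwinnertonDyer.BirchSwinnertonDyer.Theorems.EtaThetaFunctionalEquation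

variable {p : ℕ} [hp : Fact p.Prime] {r : ℤ_[p]} {S Z : IwasawaAlgebra p}

/-! ## §100 Irreducible `H_an`: all or nothing -/

/-- A monic divisor of a monic irreducible polynomial is `1` or the polynomial. [folklore] -/
theorem eq_one_or_eq_of_monic_dvd_irreducible {A B : Polynomial ℤ_[p]} (hA : A.Monic) (hB : B.Monic) (hirr : Irreducible B) (h : A ∣ B) :
    A = 1 ∨ A = B := by
  obtain ⟨G, hG⟩ := h
  rcases hirr.isUnit_or_isUnit hG with hu | hu
  · exact Or.inl (hA.isUnit_iff.mp hu)
  · refine Or.inr (Polynomial.eq_of_monic_of_associated hA hB ?_)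
    rw [hG]
    exact associated_mul_unit_right A G hu

section Readings

variable {g L : IwasawaAlgebra p} {mg mL : ℕ} {Pg PL Hg HL : Polynomial ℤ_[p]} {Ug UL : IwasawaAlgebra p} {I : Ideal (IwasawaAlgebra p)}

/-- **ALL OR NOTHING.** In the frame of Part XXXIII §98 (`I = (g)`, `L`, Weierstrass data and norm forms, `p` odd): if the norm polynomial `H_L` is
IRREDUCIBLE over `ℤ_p` then `pⁿ·L ∈ I` forces **`H_g = 1 ∨ H_g = H_L`**, i.e. **`deg P_g = ord_T g` or `deg P_g = ord_T g + 2·deg H_L`**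
(`λ_alg − r_alg ∈ {0, λ_an − r_an}`). [cite: Kobayashi2003, Thm. 4.1 (p. 8)] [cite: Washington1997, §7.1 (Thm. 7.3)] -/
theorem normPoly_eq_one_or_eq_of_pow_mul_mem_span_of_irreducible (hr : 2 * r = -1) (hS : S = X * binomialSeries ℤ_[p] r)
    (hZ : Z = X + invol p X)
    (hPg : Pg.IsDistinguishedAt (IsLocalRing.maximalIdeal ℤ_[p])) (hPL : PL.IsDistinguishedAt (IsLocalRing.maximalIdeal ℤ_[p]))
    (hUg : IsUnit Ug) (hUL : IsUnit UL)
    (hgW : g = C ((p : ℤ_[p]) ^ mg) * (Pg : IwasawaAlgebra p) * Ug) (hLW : L = C ((p : ℤ_[p]) ^ mL) * (PL : IwasawaAlgebra p) * UL)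
    (hHg : Hg.IsDistinguishedAt (IsLocalRing.maximalIdeal ℤ_[p])) (hHL : HL.IsDistinguishedAt (IsLocalRing.maximalIdeal ℤ_[p]))
    (hPHg : (Pg : IwasawaAlgebra p) = X ^ (PowerSeries.order g).toNat * (1 + X) ^ Hg.natDegree * PowerSeries.subst Z (Hg : IwasawaAlgebra p))
    (hPHL : (PL : IwasawaAlgebra p) = X ^ (PowerSeries.order L).toNat * (1 + X) ^ HL.natDegree * PowerSeries.subst Z (HL : IwasawaAlgebra p))
    (hI : I = Ideal.span {g}) {n : ℕ} (hKato : (p : IwasawaAlgebra p) ^ n * L ∈ I) (hirr : Irreducible HL) :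
    (Hg = 1 ∨ Hg = HL) ∧
      (Pg.natDegree = (PowerSeries.order g).toNat ∨ Pg.natDegree = (PowerSeries.order g).toNat + 2 * HL.natDegree) := by
  obtain ⟨-, -, hdvd⟩ := normForm_of_pow_mul_mem_span hr hS hZ hPg hPL hUg hUL hgW hLW hHg hHL hPHg hPHL hI hKato
  have hcases := eq_one_or_eq_of_monic_dvd_irreducible hHg.monic hHL.monic hirr hdvd
  have hdegPg : Pg.natDegree = (PowerSeries.order g).toNat + 2 * Hg.natDegree := by
    obtain ⟨hQdeg, hQdist⟩ := normPoly_isDistinguishedAt hHg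
    rw [normForm_polynomial_eq hZ hPHg, (Polynomial.monic_X_pow _).natDegree_mul hQdist.monic, Polynomial.natDegree_X_pow, hQdeg]
  refine ⟨hcases, ?_⟩
  rcases hcases with h1 | h2
  · left; rw [hdegPg, h1, Polynomial.natDegree_one, mul_zero, add_zero]
  · right; rw [hdegPg, h2]

end Readings

/-! ## §101 One digit: `p² ∤ h₀` ⟹ Eisenstein ⟹ irreducible -/

/-- **A distinguished polynomial with `p² ∤ h₀` is EISENSTEIN at `𝔪 = pℤ_p`** (leading coefficient `1 ∉ 𝔪`, lower coefficients in `𝔪`, `h₀ ∉ 𝔪² = (p²)`).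
[folklore] -/
theorem isEisensteinAt_of_isDistinguishedAt {H : Polynomial ℤ_[p]} (hH : H.IsDistinguishedAt (IsLocalRing.maximalIdeal ℤ_[p]))
    (h0 : ¬ (p : ℤ_[p]) ^ 2 ∣ H.coeff 0) : H.IsEisensteinAt (IsLocalRing.maximalIdeal ℤ_[p]) where
  leading := by
    rw [hH.monic.leadingCoeff]
    exact fun h ↦ (IsLocalRing.mem_maximalIdeal _).mp h isUnit_one
  mem := fun hn ↦ hH.mem hn
  notMem := by
    rw [PadicInt.maximalIdeal_eq_span_p, Ideal.span_singleton_pow, Ideal.mem_span_singleton]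
    exact h0

/-- **ONE-DIGIT IRREDUCIBILITY: a distinguished `H ∈ ℤ_p[Z]` of positive degree with `p² ∤ H(0)` is irreducible** (Eisenstein's criterion; `ℤ_p` a
domain, `H` monic hence primitive). The digit is Part XXX's: `h₀ = coeff_{ord_T}(P)`. [folklore] -/
theorem irreducible_of_isDistinguishedAt_of_not_sq_dvd {H : Polynomial ℤ_[p]} (hH : H.IsDistinguishedAt (IsLocalRing.maximalIdeal ℤ_[p]))
    (hd : 0 < H.natDegree) (h0 : ¬ (p : ℤ_[p]) ^ 2 ∣ H.coeff 0) : Irreducible H :=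
  (isEisensteinAt_of_isDistinguishedAt hH h0).irreducible (IsLocalRing.maximalIdeal.isMaximal ℤ_[p]).isPrime hH.monic.isPrimitive hd

/-- For a norm form `P = T^{r₀}(1+T)^kH(Z)` the coefficient of `P` at `T^{r₀}` is `H(0)`. [cite: Washington1997, §7.1] -/
theorem coeff_weierstrass_order_eq_coeff_zero (hZ : Z = X + invol p X) {P H : Polynomial ℤ_[p]} {r₀ : ℕ}
    (hPH : (P : IwasawaAlgebra p) = X ^ r₀ * (1 + X) ^ H.natDegree * PowerSeries.subst Z (H : IwasawaAlgebra p)) :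
    P.coeff r₀ = H.coeff 0 := by
  rw [normForm_polynomial_eq hZ hPH, coeff_X_pow_mul_normPoly]

section Readings

variable {g L : IwasawaAlgebra p} {mg mL : ℕ} {Pg PL Hg HL : Polynomial ℤ_[p]} {Ug UL : IwasawaAlgebra p} {I : Ideal (IwasawaAlgebra p)}

/-- **ONE-DIGIT ALL-OR-NOTHING.** In the frame of Part XXXIII §98: if `λ(L) > ord_T L` (`deg H_L ≥ 1`) and **`p² ∤ coeff_{ord_T L}(P_L)`** (Part XXX's
digit — on P-30L's 17 rows) then `H_L` is irreducible and `pⁿ·L ∈ I` forces **`H_g = 1 ∨ H_g = H_L`**. [cite: Kobayashi2003, Thm. 4.1 (p. 8)]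
[cite: Washington1997, §7.1 (Thm. 7.3)] -/
theorem normPoly_eq_one_or_eq_of_not_sq_dvd_coeff (hr : 2 * r = -1) (hS : S = X * binomialSeries ℤ_[p] r) (hZ : Z = X + invol p X)
    (hPg : Pg.IsDistinguishedAt (IsLocalRing.maximalIdeal ℤ_[p])) (hPL : PL.IsDistinguishedAt (IsLocalRing.maximalIdeal ℤ_[p]))
    (hUg : IsUnit Ug) (hUL : IsUnit UL)
    (hgW : g = C ((p : ℤ_[p]) ^ mg) * (Pg : IwasawaAlgebra p) * Ug) (hLW : L = C ((p : ℤ_[p]) ^ mL) * (PL : IwasawaAlgebra p) * UL)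
    (hHg : Hg.IsDistinguishedAt (IsLocalRing.maximalIdeal ℤ_[p])) (hHL : HL.IsDistinguishedAt (IsLocalRing.maximalIdeal ℤ_[p]))
    (hPHg : (Pg : IwasawaAlgebra p) = X ^ (PowerSeries.order g).toNat * (1 + X) ^ Hg.natDegree * PowerSeries.subst Z (Hg : IwasawaAlgebra p))
    (hPHL : (PL : IwasawaAlgebra p) = X ^ (PowerSeries.order L).toNat * (1 + X) ^ HL.natDegree * PowerSeries.subst Z (HL : IwasawaAlgebra p))
    (hI : I = Ideal.span {g}) {n : ℕ} (hKato : (p : IwasawaAlgebra p) ^ n * L ∈ I) (hk : 0 < HL.natDegree)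
    (hdigit : ¬ (p : ℤ_[p]) ^ 2 ∣ PL.coeff (PowerSeries.order L).toNat) :
    Irreducible HL ∧ (Hg = 1 ∨ Hg = HL) := by
  rw [coeff_weierstrass_order_eq_coeff_zero hZ hPHL] at hdigit
  have hirr := irreducible_of_isDistinguishedAt_of_not_sq_dvd hHL hk hdigit
  exact ⟨hirr, (normPoly_eq_one_or_eq_of_pow_mul_mem_span_of_irreducible hr hS hZ hPg hPL hUg hUL hgW hLW hHg hHL hPHg hPHL hI hKato hirr).1⟩

end Readings

/-! ## §102 `k = 2`, second digit: the residual discriminant -/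

/-- `H(x) = x² + h₁x + h₀` for a monic quadratic. [folklore] -/
theorem eval_eq_of_natDegree_two {H : Polynomial ℤ_[p]} (hmon : H.Monic) (h2 : H.natDegree = 2) (x : ℤ_[p]) :
    H.eval x = x ^ 2 + H.coeff 1 * x + H.coeff 0 := by
  have htop : H.coeff 2 = 1 := by rw [← h2]; exact hmon.coeff_natDegree
  rw [Polynomial.eval_eq_sum_range' (n := 3) (by omega), Finset.sum_range_succ, Finset.sum_range_succ, Finset.sum_range_succ,
    Finset.sum_range_zero, htop]
  ring

/-- **THE RESIDUAL-DISCRIMINANT TEST (no root).** `H` distinguished of degree `2` with `h₁ = p·a`, `h₀ = p²·b` and `a² − 4b` NOT congruent to a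
square mod `p` ⟹ `H` has no root in `ℤ_p`: a root lies in `pℤ_p` (Part XXXI), `z = py` gives `y² + ay + b = 0`, `(2y + a)² = a² − 4b`.
[cite: Washington1997, §7.1] -/
theorem eval_ne_zero_of_residualDisc_nonsquare {H : Polynomial ℤ_[p]} (hH : H.IsDistinguishedAt (IsLocalRing.maximalIdeal ℤ_[p]))
    (h2 : H.natDegree = 2) {a b : ℤ_[p]} (h1 : H.coeff 1 = p * a) (h0 : H.coeff 0 = (p : ℤ_[p]) ^ 2 * b)
    (hD : ∀ x : ℤ_[p], ¬ (p : ℤ_[p]) ∣ x ^ 2 - (a ^ 2 - 4 * b)) (z : ℤ_[p]) : H.eval z ≠ 0 := by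
  intro hz
  have hzm : z ∈ IsLocalRing.maximalIdeal ℤ_[p] := mem_maximalIdeal_of_root_of_isDistinguishedAt hH (by omega) hz
  rw [PadicInt.maximalIdeal_eq_span_p, Ideal.mem_span_singleton] at hzm
  obtain ⟨y, rfl⟩ := hzm
  rw [eval_eq_of_natDegree_two hH.monic h2, h1, h0] at hz
  have hp0 : (p : ℤ_[p]) ^ 2 ≠ 0 := pow_ne_zero 2 (Nat.cast_ne_zero.mpr hp.out.ne_zero)
  have hy : y ^ 2 + a * y + b = 0 := by
    have h' : (p : ℤ_[p]) ^ 2 * (y ^ 2 + a * y + b) = 0 := by linear_combination hz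
    exact (mul_eq_zero.mp h').resolve_left hp0
  exact hD (2 * y + a) ⟨0, by linear_combination 4 * hy⟩

/-- **THE RESIDUAL-DISCRIMINANT TEST (irreducibility)**: under the hypotheses of `eval_ne_zero_of_residualDisc_nonsquare`, `H` is IRREDUCIBLE (a monic
quadratic over a domain without roots). P-30M example: `H ≡ Z² + 90Z + 100 (mod 125)` at `p = 5` (`a ≡ 3`, `b ≡ 4`, `a² − 4b ≡ 3` non-residue).
[cite: Washington1997, §7.1] -/
theorem irreducible_of_residualDisc_nonsquare {H : Polynomial ℤ_[p]} (hH : H.IsDistinguishedAt (IsLocalRing.maximalIdeal ℤ_[p]))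
    (h2 : H.natDegree = 2) {a b : ℤ_[p]} (h1 : H.coeff 1 = p * a) (h0 : H.coeff 0 = (p : ℤ_[p]) ^ 2 * b)
    (hD : ∀ x : ℤ_[p], ¬ (p : ℤ_[p]) ∣ x ^ 2 - (a ^ 2 - 4 * b)) : Irreducible H := by
  refine (hH.monic.irreducible_iff_roots_eq_zero_of_degree_le_three (by omega) (by omega)).mpr ?_
  refine Multiset.eq_zero_of_forall_notMem fun z hz ↦ ?_
  exact eval_ne_zero_of_residualDisc_nonsquare hH h2 h1 h0 hD z ((Polynomial.mem_roots hH.monic.ne_zero).mp hz)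

/-! ## §103 `k = 2`, split: `‖h₁‖ = p⁻¹`, `‖h₀‖ < p⁻²` ⟹ `H = (Z − z₁)(Z − z₂)`, `‖z₁‖ < p⁻¹ = ‖z₂‖` -/

/-- A monic quadratic is `Z² + h₁Z + h₀`. [folklore] -/
theorem eq_quadratic_of_monic {H : Polynomial ℤ_[p]} (hmon : H.Monic) (h2 : H.natDegree = 2) :
    H = Polynomial.X ^ 2 + Polynomial.C (H.coeff 1) * Polynomial.X + Polynomial.C (H.coeff 0) := by
  have htop : H.coeff 2 = 1 := by rw [← h2]; exact hmon.coeff_natDegree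
  ext n
  simp only [Polynomial.coeff_add, Polynomial.coeff_X_pow, Polynomial.coeff_C_mul, Polynomial.coeff_X, Polynomial.coeff_C]
  by_cases hn0 : n = 0
  · subst hn0; simp
  by_cases hn1 : n = 1
  · subst hn1; simp
  by_cases hn2 : n = 2
  · subst hn2; simp [htop]
  have hc : H.coeff n = 0 := Polynomial.coeff_eq_zero_of_natDegree_lt (by omega)
  simp [hc, hn0, hn2, Ne.symm hn1]

/-- **THE SPLIT TEST (Hensel twice).** `H ∈ ℤ_p[Z]` monic of degree `2` with `‖h₁‖ = p⁻¹` and `‖h₀‖ < p⁻²` (`p ∥ h₁`, `p³ ∣ h₀`) factors as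
**`H = (Z − z₁)·(Z − z₂)` with `‖z₁‖ < p⁻¹` and `‖z₂‖ = p⁻¹`** (so `z₁ ≠ z₂`): Hensel's lemma at `a₀ = 0` (`H(0) = h₀`, `H′(0) = h₁`) and at
`a₀ = −h₁` (`H(−h₁) = h₀`, `H′(−h₁) = −h₁`). P-30M examples at `p = 5`: `H ≡ Z² + 30Z`, `Z² + 105Z`, `Z² + 50Z (mod 125)`. [folklore] -/
theorem exists_split_of_norm_coeff {H : Polynomial ℤ_[p]} (hmon : H.Monic) (h2 : H.natDegree = 2)
    (h1 : ‖H.coeff 1‖ = (p : ℝ)⁻¹) (h0 : ‖H.coeff 0‖ < (p : ℝ)⁻¹ ^ 2) :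
    ∃ z₁ z₂ : ℤ_[p], H = (Polynomial.X - Polynomial.C z₁) * (Polynomial.X - Polynomial.C z₂) ∧
      ‖z₁‖ < (p : ℝ)⁻¹ ∧ ‖z₂‖ = (p : ℝ)⁻¹ ∧ z₁ ≠ z₂ ∧ H.eval z₁ = 0 ∧ H.eval z₂ = 0 := by
  have hH := eq_quadratic_of_monic hmon h2
  have hev : ∀ x : ℤ_[p], H.eval x = x ^ 2 + H.coeff 1 * x + H.coeff 0 := eval_eq_of_natDegree_two hmon h2
  have hder : ∀ x : ℤ_[p], H.derivative.eval x = 2 * x + H.coeff 1 := fun x ↦ by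
    conv_lhs => rw [hH]
    simp only [Polynomial.derivative_add, Polynomial.derivative_X_pow, Polynomial.derivative_mul, Polynomial.derivative_C,
      Polynomial.derivative_X, zero_mul, mul_one, zero_add, add_zero, Polynomial.eval_add, Polynomial.eval_mul,
      Polynomial.eval_C, Polynomial.eval_X, Polynomial.eval_pow, Nat.cast_ofNat, map_ofNat, Polynomial.eval_ofNat]
    ring
  have hp1 : ‖H.coeff 1‖ ≠ 0 := by rw [h1]; exact inv_ne_zero (Nat.cast_ne_zero.mpr hp.out.ne_zero)
  have e1 : H.eval 0 = H.coeff 0 := by rw [hev]; ring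
  have e2 : H.derivative.eval 0 = H.coeff 1 := by rw [hder]; ring
  have e3 : H.eval (-H.coeff 1) = H.coeff 0 := by rw [hev]; ring
  have e4 : H.derivative.eval (-H.coeff 1) = -H.coeff 1 := by rw [hder]; ring
  -- Hensel at 0
  have hn₁ : ‖Polynomial.aeval (0 : ℤ_[p]) H‖ < ‖Polynomial.aeval (0 : ℤ_[p]) (Polynomial.derivative H)‖ ^ 2 := by
    rw [Polynomial.coe_aeval_eq_eval, e1, e2, h1]; exact h0
  obtain ⟨z₁, hz₁, hz₁a, -, -⟩ := hensels_lemma hn₁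
  rw [Polynomial.coe_aeval_eq_eval] at hz₁ hz₁a
  rw [sub_zero, e2, h1] at hz₁a
  -- Hensel at −h₁
  have hn₂ : ‖Polynomial.aeval (-H.coeff 1) H‖ < ‖Polynomial.aeval (-H.coeff 1) (Polynomial.derivative H)‖ ^ 2 := by
    rw [Polynomial.coe_aeval_eq_eval, e3, e4, norm_neg, h1]; exact h0
  obtain ⟨z₂, hz₂, hz₂a, -, -⟩ := hensels_lemma hn₂
  rw [Polynomial.coe_aeval_eq_eval] at hz₂ hz₂a
  rw [sub_neg_eq_add, e4, norm_neg] at hz₂a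
  have hz₂n : ‖z₂‖ = (p : ℝ)⁻¹ := by
    have e : z₂ = (z₂ + H.coeff 1) + -H.coeff 1 := by ring
    rw [e, PadicInt.norm_add_eq_max_of_ne (by rw [norm_neg]; exact hz₂a.ne), norm_neg, max_eq_right hz₂a.le, h1]
  rw [h1] at hz₂a
  have hne : z₁ ≠ z₂ := fun h ↦ by rw [h, hz₂n] at hz₁a; exact lt_irrefl _ hz₁a
  -- factor
  have hfac : (Polynomial.X - Polynomial.C z₂) * (H /ₘ (Polynomial.X - Polynomial.C z₂)) = H :=
    Polynomial.mul_divByMonic_eq_iff_isRoot.mpr hz₂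
  set Q := H /ₘ (Polynomial.X - Polynomial.C z₂) with hQ
  have hQmon : Q.Monic := (Polynomial.monic_X_sub_C z₂).of_mul_monic_left (by rw [hfac]; exact hmon)
  have hQdeg : Q.natDegree = 1 := by
    rw [hQ, Polynomial.natDegree_divByMonic _ (Polynomial.monic_X_sub_C z₂), Polynomial.natDegree_X_sub_C, h2]
  have hQ1 : Q = Polynomial.X + Polynomial.C (Q.coeff 0) := hQmon.eq_X_add_C hQdeg
  have hQz₁ : Q.coeff 0 = -z₁ := by
    have h := hz₁
    rw [← hfac, Polynomial.eval_mul, Polynomial.eval_sub, Polynomial.eval_X, Polynomial.eval_C, hQ1, Polynomial.eval_add, Polynomial.eval_X,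
      Polynomial.eval_C] at h
    have h' := (mul_eq_zero.mp h).resolve_left (sub_ne_zero.mpr hne)
    linear_combination h'
  refine ⟨z₁, z₂, ?_, hz₁a, hz₂n, hne, hz₁, hz₂⟩
  rw [← hfac, hQ1, hQz₁, map_neg, ← sub_eq_add_neg, mul_comm]

/-- An element of `ℤ_p` of norm `p⁻¹` (valuation `1`) is not a square. [folklore] -/
theorem not_isSquare_of_norm_eq_inv {z : ℤ_[p]} (hz : ‖z‖ = (p : ℝ)⁻¹) : ¬ IsSquare z := by
  rintro ⟨s, rfl⟩
  have hs0 : s ≠ 0 := fun h ↦ by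
    rw [h, mul_zero, norm_zero] at hz
    exact (inv_ne_zero (Nat.cast_ne_zero.mpr hp.out.ne_zero)) hz.symm
  have hp1 : (1 : ℝ) < p := Nat.one_lt_cast.mpr hp.out.one_lt
  rw [norm_mul, PadicInt.norm_eq_zpow_neg_valuation hs0, ← zpow_add₀ (by positivity), ← zpow_neg_one,
    zpow_right_inj₀ (by positivity) hp1.ne'] at hz
  omega

/-! ## §104 Monic divisors of a split quadratic; the all-four reading on a split row -/

/-- **The monic divisors of `(Z − z₁)(Z − z₂)` over a domain are `1`, `Z − z₁`, `Z − z₂` and the product** (degree count; a monic linear divisor `Z + c`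
vanishes at `−c`, so `(−c − z₁)(−c − z₂) = 0`). No unique factorisation is used. [folklore] -/
theorem eq_of_monic_dvd_X_sub_C_mul {A : Polynomial ℤ_[p]} (hA : A.Monic) {z₁ z₂ : ℤ_[p]}
    (h : A ∣ (Polynomial.X - Polynomial.C z₁) * (Polynomial.X - Polynomial.C z₂)) :
    A = 1 ∨ A = Polynomial.X - Polynomial.C z₁ ∨ A = Polynomial.X - Polynomial.C z₂ ∨
      A = (Polynomial.X - Polynomial.C z₁) * (Polynomial.X - Polynomial.C z₂) := by
  set B := (Polynomial.X - Polynomial.C z₁) * (Polynomial.X - Polynomial.C z₂) with hB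
  have hBmon : B.Monic := (Polynomial.monic_X_sub_C z₁).mul (Polynomial.monic_X_sub_C z₂)
  have hBdeg : B.natDegree = 2 := by
    rw [hB, (Polynomial.monic_X_sub_C z₁).natDegree_mul (Polynomial.monic_X_sub_C z₂), Polynomial.natDegree_X_sub_C,
      Polynomial.natDegree_X_sub_C]
  have hdeg : A.natDegree ≤ 2 := hBdeg ▸ Polynomial.natDegree_le_of_dvd h hBmon.ne_zero
  rcases Nat.lt_or_ge A.natDegree 1 with hd0 | hd1
  · exact Or.inl (Polynomial.eq_one_of_monic_natDegree_zero hA (by omega))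
  rcases hd1.lt_or_eq with hd2 | hd1'
  · have hA2 : A.natDegree = 2 := by omega
    exact Or.inr (Or.inr (Or.inr (Polynomial.eq_of_monic_of_dvd_of_natDegree_le hA hBmon h (by rw [hA2, hBdeg])).symm))
  · have hA1 := hA.eq_X_add_C hd1'.symm
    have hroot : B.eval (-A.coeff 0) = 0 := by
      refine Polynomial.eval_eq_zero_of_dvd_of_eval_eq_zero h ?_
      rw [hA1, Polynomial.eval_add, Polynomial.eval_X, Polynomial.eval_C, Polynomial.coeff_add, Polynomial.coeff_X_zero,
        Polynomial.coeff_C_zero, zero_add, neg_add_cancel]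
    rw [hB, Polynomial.eval_mul, Polynomial.eval_sub, Polynomial.eval_sub, Polynomial.eval_X, Polynomial.eval_C, Polynomial.eval_C] at hroot
    rcases mul_eq_zero.mp hroot with h₁ | h₂
    · right; left
      rw [hA1, show A.coeff 0 = -z₁ by linear_combination -h₁, map_neg, sub_eq_add_neg]
    · right; right; left
      rw [hA1, show A.coeff 0 = -z₂ by linear_combination -h₂, map_neg, sub_eq_add_neg]

section Readings

variable {g L : IwasawaAlgebra p} {mg mL : ℕ} {Pg PL Hg HL : Polynomial ℤ_[p]} {Ug UL : IwasawaAlgebra p} {I : Ideal (IwasawaAlgebra p)}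

/-- **THE ALL-FOUR READING ON A SPLIT ROW.** In the frame of Part XXXIII §98: if `H_L = (Z − z₁)(Z − z₂)` then `pⁿ·L ∈ I` forces
**`H_g ∈ {1, Z − z₁, Z − z₂, H_L}`** — `λ_alg − r_alg ∈ {0, 2, 4}`, each value of `2` attached to ONE of the two (non-partner) `ι`-orbits of zeros.
With `exists_split_of_norm_coeff`: the rows cm256j8000_m7, cm36a2_13 of P-30M. [cite: Kobayashi2003, Thm. 4.1 (p. 8)]
[cite: Washington1997, §7.1 (Thm. 7.3)] -/
theorem normPoly_mem_four_of_pow_mul_mem_span_of_split (hr : 2 * r = -1) (hS : S = X * binomialSeries ℤ_[p] r) (hZ : Z = X + invol p X)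
    (hPg : Pg.IsDistinguishedAt (IsLocalRing.maximalIdeal ℤ_[p])) (hPL : PL.IsDistinguishedAt (IsLocalRing.maximalIdeal ℤ_[p]))
    (hUg : IsUnit Ug) (hUL : IsUnit UL)
    (hgW : g = C ((p : ℤ_[p]) ^ mg) * (Pg : IwasawaAlgebra p) * Ug) (hLW : L = C ((p : ℤ_[p]) ^ mL) * (PL : IwasawaAlgebra p) * UL)
    (hHg : Hg.IsDistinguishedAt (IsLocalRing.maximalIdeal ℤ_[p])) (hHL : HL.IsDistinguishedAt (IsLocalRing.maximalIdeal ℤ_[p]))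
    (hPHg : (Pg : IwasawaAlgebra p) = X ^ (PowerSeries.order g).toNat * (1 + X) ^ Hg.natDegree * PowerSeries.subst Z (Hg : IwasawaAlgebra p))
    (hPHL : (PL : IwasawaAlgebra p) = X ^ (PowerSeries.order L).toNat * (1 + X) ^ HL.natDegree * PowerSeries.subst Z (HL : IwasawaAlgebra p))
    (hI : I = Ideal.span {g}) {n : ℕ} (hKato : (p : IwasawaAlgebra p) ^ n * L ∈ I) {z₁ z₂ : ℤ_[p]}
    (hsplit : HL = (Polynomial.X - Polynomial.C z₁) * (Polynomial.X - Polynomial.C z₂)) :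
    Hg = 1 ∨ Hg = Polynomial.X - Polynomial.C z₁ ∨ Hg = Polynomial.X - Polynomial.C z₂ ∨ Hg = HL := by
  obtain ⟨-, -, hdvd⟩ := normForm_of_pow_mul_mem_span hr hS hZ hPg hPL hUg hUL hgW hLW hHg hHL hPHg hPHL hI hKato
  rw [hsplit] at hdvd ⊢
  exact eq_of_monic_dvd_X_sub_C_mul hHg.monic hdvd

end Readings

end Summit.BirchSwinnertonDyer.BirchSwinnertonDyer.Theorems.EtaThetaFunctionalEquation

end
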